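import Literature.Barriers.RiemannHypothesis.TuranPartialSumsCheckArith
import HarnessLib

/-!
# Sections of `ζ` beyond `σ = 1`: soundness of the certificate checker, II (phases and stripping)

Barrier catalogue `Literature/Barriers/RiemannHypothesis/`, continuation of
`TuranPartialSumsCheckArith.lean`. Pure proof file (nothing is defined or asserted), about the phase
function `phaseOf es` of a certificate (`ω(p) = (x + iy)/d`, unimodular on the keys: `norm_phaseOf`)
and the bookkeeping products `keyPow`, `phasePow`, `denPow` of `TuranPartialSumsCheckDefs.lean`.

* `stripGo_spec`: stripping the keys out of `m ≥ 1` returns a cofactor `m'` with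
  `m' ∏ p^{v_p(m)} = m`, divisible by no key, together with `∏ (x_p + i y_p)^{v_p(m)}` and
  `∏ d_p^{v_p(m)}` (when the fuel suffices, i.e. `m' ≠ 0`);
* hence `m' = 1` iff `m` is `S`-smooth (`smooth_iff_of_strip`), `m' = m` iff no key divides `m`
  (`eq_self_iff_of_strip`), and for smooth `m` the completely multiplicative extension `a_ω(m)`
  (`complMul`, `DavenportHeilbronnSeries.lean`) satisfies
  `a_ω(m) ∏ d_p^{v_p} = ∏ (x_p + iy_p)^{v_p}` (`complMul_mul_denPow`).

## References

* [PlattTrudgian2016] D. J. Platt, T. S. Trudgian, LMS J. Comput. Math. 19 (2016), §2.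
-/

namespace Literature.Barriers.RiemannHypothesis.TuranCheck

open Literature.Barriers.RiemannHypothesis Complex

/-! ### The phases and the bookkeeping products -/

/-- Empty product. [folklore] -/
@[simp] theorem keyPow_nil (m : ℕ) : keyPow [] m = 1 := by simp [keyPow]
/-- Empty product. [folklore] -/
@[simp] theorem phasePow_nil (m : ℕ) : phasePow [] m = 1 := by simp [phasePow]
/-- Empty product. [folklore] -/
@[simp] theorem denPow_nil (m : ℕ) : denPow [] m = 1 := by simp [denPow]

/-- Head factor. [folklore] -/
theorem keyPow_cons (e : ℕ × ℤ × ℤ × ℕ) (es : List (ℕ × ℤ × ℤ × ℕ)) (m : ℕ) :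
    keyPow (e :: es) m = e.1 ^ m.factorization e.1 * keyPow es m := by
  simp [keyPow]

/-- Head factor. [folklore] -/
theorem phasePow_cons (e : ℕ × ℤ × ℤ × ℕ) (es : List (ℕ × ℤ × ℤ × ℕ)) (m : ℕ) :
    phasePow (e :: es) m =
      (((e.2.1 : ℤ) : ℂ) + ((e.2.2.1 : ℤ) : ℂ) * I) ^ m.factorization e.1 * phasePow es m := by
  simp [phasePow]

/-- Head factor. [folklore] -/
theorem denPow_cons (e : ℕ × ℤ × ℤ × ℕ) (es : List (ℕ × ℤ × ℤ × ℕ)) (m : ℕ) :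
    denPow (e :: es) m = e.2.2.2 ^ m.factorization e.1 * denPow es m := by
  simp [denPow]

/-- The products depend only on the exponents at the keys. [folklore] -/
theorem pow_congr_of_keys {es : List (ℕ × ℤ × ℤ × ℕ)} {m m' : ℕ}
    (h : ∀ e ∈ es, m.factorization e.1 = m'.factorization e.1) :
    keyPow es m = keyPow es m' ∧ phasePow es m = phasePow es m' ∧ denPow es m = denPow es m' := by
  refine ⟨?_, ?_, ?_⟩
  · rw [keyPow, keyPow, List.map_congr_left (fun e he ↦ by rw [h e he])]
  · rw [phasePow, phasePow, List.map_congr_left (fun e he ↦ by rw [h e he])]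
  · rw [denPow, denPow, List.map_congr_left (fun e he ↦ by rw [h e he])]

/-- `denPow es m > 0` for a certificate with positive denominators. [folklore] -/
theorem denPow_pos {es : List (ℕ × ℤ × ℤ × ℕ)} (h : ∀ e ∈ es, 0 < e.2.2.2) (m : ℕ) :
    0 < denPow es m := by
  induction es with
  | nil => simp
  | cons e es ih =>
    rw [denPow_cons]
    exact Nat.mul_pos (pow_pos (h e (by simp)) _) (ih fun e' he' ↦ h e' (by simp [he']))

/-- `ω` is unimodular at the keys of a valid certificate. [folklore] -/
theorem norm_phaseOf {es : List (ℕ × ℤ × ℤ × ℕ)} (hv : Valid es) {p : ℕ} (hp : p ∈ es.map (·.1)) :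
    ‖phaseOf es p‖ = 1 := by
  induction es with
  | nil => simp at hp
  | cons e es ih =>
    obtain ⟨q, x, y, d⟩ := e
    rw [phaseOf]
    by_cases hpq : p = q
    · subst hpq
      rw [if_pos rfl]
      have hd : (0 : ℝ) < d := by exact_mod_cast hv.den_pos _ (List.mem_cons_self ..)
      have hxy : (x : ℝ) * x + y * y = (d : ℝ) * d := by
        have := hv.pyth _ (List.mem_cons_self ..)
        simp only at this
        exact_mod_cast this
      have hn : ‖(x : ℂ) + (y : ℂ) * I‖ = d := by
        have h2 : ‖(x : ℂ) + (y : ℂ) * I‖ ^ 2 = (d : ℝ) ^ 2 := by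
          rw [Complex.sq_norm, Complex.normSq_apply]
          simp only [add_re, intCast_re, mul_re, I_re, mul_zero, intCast_im, I_im, mul_one,
            sub_self, add_zero, add_im, mul_im, zero_add]
          nlinarith [hxy]
        have := norm_nonneg ((x : ℂ) + (y : ℂ) * I)
        nlinarith [h2]
      rw [norm_div, hn, Complex.norm_natCast, div_self hd.ne']
    · rw [if_neg hpq]
      rw [List.map_cons, List.mem_cons] at hp
      exact ih hv.tail (hp.resolve_left hpq)

/-- Off the head key, `ω` is read from the tail. [folklore] -/
theorem phaseOf_cons_of_ne {q : ℕ} {x y : ℤ} {d : ℕ} {es : List (ℕ × ℤ × ℤ × ℕ)} {p : ℕ}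
    (h : p ≠ q) : phaseOf ((q, x, y, d) :: es) p = phaseOf es p := by
  rw [phaseOf, if_neg h]

/-! ### Stripping: the specification -/

/-- For a prime `p ∣ m ≠ 0`: the exponents of `m / p`. [folklore] -/
theorem factorization_div_prime {p m : ℕ} (hp : p.Prime) (hpm : p ∣ m) (q : ℕ) :
    (m / p).factorization q = if q = p then m.factorization p - 1 else m.factorization q := by
  rw [Nat.factorization_div hpm, hp.factorization]
  simp only [Finsupp.coe_tsub, Pi.sub_apply]
  by_cases hq : q = p
  · subst hq; simp
  · rw [if_neg hq, Finsupp.single_eq_of_ne hq, Nat.sub_zero]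

/-- **Specification of `stripGo`.** For a valid certificate and `m ≥ 1`: if the returned cofactor
`m'` is non-zero then `m' · ∏ p^{v_p(m)} = m`, no key divides `m'`, the Gaussian numerator was
multiplied by `∏ (x_p + iy_p)^{v_p(m)}` and the denominator by `∏ d_p^{v_p(m)}`. [folklore] -/
theorem stripGo_spec : ∀ (fuel : ℕ) (es : List (ℕ × ℤ × ℤ × ℕ)) (m : ℕ) (gr gi : ℤ) (D : ℕ),
    Valid es → 1 ≤ m → (stripGo fuel es m gr gi D).1 ≠ 0 →
      (stripGo fuel es m gr gi D).1 * keyPow es m = m ∧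
      (∀ q ∈ es.map (·.1), ¬ q ∣ (stripGo fuel es m gr gi D).1) ∧
      (((stripGo fuel es m gr gi D).2.1 : ℂ) + ((stripGo fuel es m gr gi D).2.2.1 : ℂ) * I =
        ((gr : ℂ) + (gi : ℂ) * I) * phasePow es m) ∧
      (stripGo fuel es m gr gi D).2.2.2 = D * denPow es m := by
  intro fuel
  induction fuel with
  | zero => intro es m gr gi D _ _ h; simp [stripGo] at h
  | succ fuel ih =>
    intro es m gr gi D hv hm hne
    cases es with
    | nil => simp [stripGo]
    | cons e es =>
      obtain ⟨p, x, y, d⟩ := e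
      have hp : p.Prime := hv.prime _ (List.mem_cons_self ..)
      have hm0 : m ≠ 0 := by omega
      rw [stripGo] at hne ⊢
      simp only [nat_mod_eq', nat_div_eq', nat_mul_eq, int_sub_eq, int_mul_eq, int_add_eq] at hne ⊢
      cases hb : Nat.beq (m % p) 0 with
      | false =>
        -- `p ∤ m`: pass to the tail
        rw [hb] at hne
        simp only [cond_false] at hne ⊢
        rw [beq_false_iff] at hb
        have hpm : ¬ p ∣ m := fun h ↦ hb (Nat.mod_eq_zero_of_dvd h)
        have hv0 : m.factorization p = 0 := Nat.factorization_eq_zero_of_not_dvd hpm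
        obtain ⟨h1, h2, h3, h4⟩ := ih es m gr gi D hv.tail hm hne
        refine ⟨?_, ?_, ?_, ?_⟩
        · rw [keyPow_cons]; simpa [hv0] using h1
        · intro q hq
          rw [List.map_cons, List.mem_cons] at hq
          rcases hq with rfl | hq
          · intro hq'
            exact hpm (hq'.trans (Dvd.intro _ h1))
          · exact h2 q hq
        · rw [phasePow_cons]; simpa [hv0] using h3
        · rw [denPow_cons]; simpa [hv0] using h4
      | true =>
        -- `p ∣ m`: divide once and recurse on the same list
        rw [hb] at hne
        simp only [cond_true] at hne ⊢
        rw [beq_true_iff] at hb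
        have hpm : p ∣ m := Nat.dvd_of_mod_eq_zero hb
        have hm' : 1 ≤ m / p := Nat.div_pos (Nat.le_of_dvd (by omega) hpm) hp.pos
        have hvp : 1 ≤ m.factorization p := hp.factorization_pos_of_dvd hm0 hpm
        obtain ⟨h1, h2, h3, h4⟩ :=
          ih ((p, x, y, d) :: es) (m / p) (gr * x - gi * y) (gr * y + gi * x) (D * d) hv hm' hne
        -- exponents of `m / p` versus those of `m`
        have hfe : (m / p).factorization p = m.factorization p - 1 := by
          rw [factorization_div_prime hp hpm, if_pos rfl]
        have hfo : ∀ e ∈ es, (m / p).factorization e.1 = m.factorization e.1 := by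
          intro e he
          have hne' : e.1 ≠ p := Nat.ne_of_gt (hv.head_lt e he)
          rw [factorization_div_prime hp hpm, if_neg hne']
        obtain ⟨hk, hph, hdn⟩ := pow_congr_of_keys (es := es) hfo
        have hkey : keyPow ((p, x, y, d) :: es) m = p * keyPow ((p, x, y, d) :: es) (m / p) := by
          rw [keyPow_cons, keyPow_cons, hk, hfe, ← mul_assoc]
          congr 1
          conv_lhs => rw [show m.factorization p = (m.factorization p - 1) + 1 by omega, pow_succ]
          ring
        have hpha : phasePow ((p, x, y, d) :: es) m =
            ((x : ℂ) + (y : ℂ) * I) * phasePow ((p, x, y, d) :: es) (m / p) := by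
          rw [phasePow_cons, phasePow_cons, hph, hfe, ← mul_assoc]
          congr 1
          conv_lhs => rw [show m.factorization p = (m.factorization p - 1) + 1 by omega, pow_succ]
          simp only
          ring
        have hdna : denPow ((p, x, y, d) :: es) m = d * denPow ((p, x, y, d) :: es) (m / p) := by
          rw [denPow_cons, denPow_cons, hdn, hfe, ← mul_assoc]
          congr 1
          conv_lhs => rw [show m.factorization p = (m.factorization p - 1) + 1 by omega, pow_succ]
          simp only
          ring
        refine ⟨?_, h2, ?_, ?_⟩
        · rw [hkey, ← mul_assoc, mul_comm _ p, mul_assoc, h1, Nat.mul_div_cancel' hpm]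
        · rw [h3, hpha]
          push_cast
          linear_combination
            (-(gi : ℂ) * y * phasePow ((p, x, y, d) :: es) (m / p)) * Complex.I_mul_I
        · rw [h4, hdna]; ring

/-- The cofactor of `stripAll` in terms of `stripGo`. [folklore] -/
theorem stripAll_eq (es : List (ℕ × ℤ × ℤ × ℕ)) (m : ℕ) : stripAll es m = stripGo 128 es m 1 0 1 :=
  rfl

/-- **Smoothness.** If the cofactor `m'` of `m ≥ 1` is non-zero: `m' = 1` iff every prime factor of
`m` is a key. [folklore] -/
theorem smooth_iff_of_strip {es : List (ℕ × ℤ × ℤ × ℕ)} (hv : Valid es) {m : ℕ} (hm : 1 ≤ m)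
    (hne : (stripAll es m).1 ≠ 0) :
    (stripAll es m).1 = 1 ↔ m.primeFactors ⊆ (es.map (·.1)).toFinset := by
  obtain ⟨h1, h2, -, -⟩ := stripGo_spec 128 es m 1 0 1 hv hm hne
  rw [stripAll_eq]
  constructor
  · intro hone q hq
    rw [List.mem_toFinset]
    have hqp : q.Prime := Nat.prime_of_mem_primeFactors hq
    have hqm : q ∣ m := Nat.dvd_of_mem_primeFactors hq
    rw [hone, one_mul] at h1
    rw [← h1, keyPow] at hqm
    obtain ⟨a, ha, hqa⟩ := (Prime.dvd_prod_iff hqp.prime).1 hqm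
    obtain ⟨e, he, rfl⟩ := List.mem_map.1 ha
    have := hqp.dvd_of_dvd_pow hqa
    rw [(Nat.prime_dvd_prime_iff_eq hqp (hv.prime e he)).1 this]
    exact List.mem_map.2 ⟨e, he, rfl⟩
  · intro hsub
    by_contra hone
    set m' := (stripGo 128 es m 1 0 1).1 with hm'
    have hq := Nat.minFac_prime hone
    have hqm' : m'.minFac ∣ m' := Nat.minFac_dvd m'
    have hqm : m'.minFac ∣ m := hqm'.trans (Dvd.intro _ h1)
    have hmem : m'.minFac ∈ m.primeFactors := Nat.mem_primeFactors.2 ⟨hq, hqm, by omega⟩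
    have hkey := List.mem_toFinset.1 (hsub hmem)
    exact h2 _ hkey hqm'

/-- **Free primes.** If the cofactor of `m ≥ 1` is non-zero: it equals `m` iff no key divides `m`.
[folklore] -/
theorem eq_self_iff_of_strip {es : List (ℕ × ℤ × ℤ × ℕ)} (hv : Valid es) {m : ℕ} (hm : 1 ≤ m)
    (hne : (stripAll es m).1 ≠ 0) :
    (stripAll es m).1 = m ↔ ∀ q ∈ es.map (·.1), ¬ q ∣ m := by
  obtain ⟨h1, h2, -, -⟩ := stripGo_spec 128 es m 1 0 1 hv hm hne
  rw [stripAll_eq]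
  constructor
  · intro hself q hq; rw [← hself]; exact h2 q hq
  · intro hno
    have hk : keyPow es m = 1 := by
      rw [keyPow]
      refine List.prod_eq_one fun a ha ↦ ?_
      obtain ⟨e, he, rfl⟩ := List.mem_map.1 ha
      have : m.factorization e.1 = 0 :=
        Nat.factorization_eq_zero_of_not_dvd (hno e.1 (List.mem_map.2 ⟨e, he, rfl⟩))
      rw [this, pow_zero]
    rw [hk, mul_one] at h1
    exact h1

/-- **The phases of smooth numbers.** For a valid certificate and an `S`-smooth `m ≥ 1`:
`a_ω(m) · ∏ d_p^{v_p(m)} = ∏ (x_p + i y_p)^{v_p(m)}`. [folklore] -/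
theorem complMul_mul_denPow : ∀ (es : List (ℕ × ℤ × ℤ × ℕ)), Valid es → ∀ m : ℕ, 1 ≤ m →
    m.primeFactors ⊆ (es.map (·.1)).toFinset →
      complMul (phaseOf es) m * (denPow es m : ℂ) = phasePow es m := by
  intro es
  induction es with
  | nil =>
    intro _ m hm hsub
    have : m = 1 := by
      have h0 : m.primeFactors = ∅ := Finset.subset_empty.1 (by simpa using hsub)
      rcases Nat.primeFactors_eq_empty.1 h0 with h | h
      · omega
      · exact h
    subst this
    simp
  | cons e es ih =>
    intro hv m hm hsub
    obtain ⟨p, x, y, d⟩ := e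
    have hp : p.Prime := hv.prime _ (List.mem_cons_self ..)
    have hd : 0 < d := hv.den_pos _ (List.mem_cons_self ..)
    have hm0 : m ≠ 0 := by omega
    -- split `m = p^v · m₁` with `p ∤ m₁`
    set v := m.factorization p with hvdef
    set m₁ := m / p ^ v with hm₁
    have hsplit : p ^ v * m₁ = m := Nat.ordProj_mul_ordCompl_eq_self m p
    have hm₁0 : m₁ ≠ 0 := by
      intro h; rw [h, mul_zero] at hsplit; exact hm0 hsplit.symm
    have hm₁1 : 1 ≤ m₁ := Nat.one_le_iff_ne_zero.2 hm₁0
    have hpm₁ : ¬ p ∣ m₁ := Nat.not_dvd_ordCompl hp hm0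
    have hfac₁ : ∀ q, q ≠ p → m₁.factorization q = m.factorization q := by
      intro q hq
      rw [hm₁, hvdef, Nat.factorization_ordCompl, Finsupp.erase_ne hq]
    -- the prime factors of `m₁` are keys of the tail
    have hsub₁ : m₁.primeFactors ⊆ (es.map (·.1)).toFinset := by
      intro q hq
      have hqp : q.Prime := Nat.prime_of_mem_primeFactors hq
      have hqm₁ : q ∣ m₁ := Nat.dvd_of_mem_primeFactors hq
      have hqne : q ≠ p := fun h ↦ hpm₁ (h ▸ hqm₁)
      have hqm : q ∈ m.primeFactors :=
        Nat.mem_primeFactors.2 ⟨hqp, hqm₁.trans ⟨p ^ v, by rw [mul_comm]; exact hsplit.symm⟩, hm0⟩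
      have := hsub hqm
      rw [List.map_cons, List.toFinset_cons, Finset.mem_insert] at this
      exact this.resolve_left hqne
    have ih' := ih hv.tail m₁ hm₁1 hsub₁
    -- `a_ω(m) = ω(p)^v a_ω(m₁)` and `ω` on `m₁` is read from the tail
    have hmul : complMul (phaseOf ((p, x, y, d) :: es)) m =
        (((x : ℂ) + (y : ℂ) * I) / (d : ℂ)) ^ v * complMul (phaseOf es) m₁ := by
      conv_lhs => rw [← hsplit]
      rw [map_mul, complMul_prime_pow _ hp, phaseOf, if_pos rfl,
        complMul_congr (φ := phaseOf ((p, x, y, d) :: es)) (ψ := phaseOf es) (fun q hq ↦ ?_)]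
      have hqne : q ≠ p := fun h ↦ hpm₁ (h ▸ Nat.dvd_of_mem_primeFactors hq)
      exact phaseOf_cons_of_ne hqne
    -- the products over the tail are those of `m₁`
    obtain ⟨-, hph, hdn⟩ := pow_congr_of_keys (es := es) (m := m₁) (m' := m)
      (fun e he ↦ hfac₁ e.1 (Nat.ne_of_gt (hv.head_lt e he)))
    rw [hmul, denPow_cons, phasePow_cons, ← hdn, ← hph, ← ih']
    have hdC : (d : ℂ) ≠ 0 := by exact_mod_cast hd.ne'
    simp only [Nat.cast_mul, Nat.cast_pow]
    rw [div_pow]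
    field_simp
    ring

end Literature.Barriers.RiemannHypothesis.TuranCheck
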